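/-
Copyright (c) 2026 the pub-hodgecm-mathlib formalisation cell (harness21).  Prover seat hodgecm-mathlib-K2Liu-p13 (g2), Track B «K2-LIT»,
#184♮ = hLiu418 = `stmt-HodgeConjecture-24832`; Road I v3 organ U1-CT-ind STAGE 2 (Q2), file F4-2c (LEAD F0P6-plan (g14) 10:39:33Z ∕ 11:15:51Z «F4 → F5 → D-U1 stage 3 =»).
-/
import Summits.HodgeConjecture.HodgeConjecture.Theorems.K2LiuSiegelQuotSubgroupOrbitUnfold     -- ★ F4-2b: `tsum_section_eq_integral_wt_smul_subgroup`, `lintegral_enorm_section_unfold`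
import Summits.HodgeConjecture.HodgeConjecture.Theorems.K2LiuCoveringWeightTransport           -- ★ α1 (K2Liu-p10): `isCoveringWeight_comp`, `integral_wt_smul_comp_mulEquiv`
import HarnessLib

/-!
# Crux `HLiu418`, Road I v3, organ U1 stage 2 (Q2), file F4-2c: THE SUM OVER ONE `N(L⁺)`-ORBIT OF `P_Δ(L⁺)\H(L⁺)` AS ONE WEIGHTED INTEGRAL, AND ITS
# TRANSPORT ALONG A CONJUGATION `u ↦ P u P⁻¹` — for an ARBITRARY subgroup `N ≤ H(𝔸)`

Cell `hodgecm-mathlib`, crux item hLiu418 = `stmt-HodgeConjecture-24832`; squad K2 ∕ K2Liu; LEAD F0P6-plan (g14), co-dealer K2E5-plan (g7); prover K2Liu-p13 (g2).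
THEOREMS ONLY (no `def`, no instance, no notation, no named-fact hypothesis, no `sorry`); lane `--supports stmt-HodgeConjecture-24832 --as helper` (count-neutral).
SETTING as ★ F4-2b: `Nsub ≤ H(𝔸)` with Borel structure, lattice `N(L⁺) = (ratH).subgroupOf Nsub`, `νN` left-invariant, `β` an `N(L⁺)`-covering weight, `f` a continuous
Siegel section, `γ₀ ∈ H(L⁺)`, `h ∈ H(𝔸)`; the ORBIT `O(γ₀) = {⟦γ₀ ν⟧ : ν ∈ N(L⁺)}` as a SET of classes and its piece of the (H)-binder
`∫⁻ (Σ'_{q ∈ O(γ₀)} ‖f(γ_q u h)‖ₑ) β dνN ≠ ∞`.  This is ★ α2a `K2LiuSiegelMiddleOrbitUnfold` ∕ ★ α3-1∕α3-2 (K2Liu-p10, typed for `unipDelta`) for ANY `Nsub`: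
* §1 **`exists_section_of_orbit`** — for `Γ' = Stab(γ₀)` (membership law `u ∈ Γ' ↔ u ∈ H(L⁺) ∧ γ₀ u γ₀⁻¹ ∈ P_Δ`) the orbit set carries a section `q ↦ ν_q` of `Γ'\N(L⁺)`
  with `⟦γ₀ ν_q⟧ = q` (★ F4-2b `mk_mul_coe_eq_mk_mul_coe_iff`).
* §2 **`lintegral_orbit_ne_top_subgroup`**, **`tsum_orbit_eq_integral_wt_smul_subgroup'`** — for ANY `Γ'`-covering weight `β₁`:
  `Σ'_{q ∈ O(γ₀)} ∫ β(u) • f(γ_q u h) dνN = ∫ β₁(u) • f(γ₀ u h) dνN` (★ F4-2b over that section).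
* §3 THE CONJUGATION TRANSPORT: `exists_conj_mulEquiv_subgroup` (`u ↦ P u P⁻¹` as a `MulEquiv` of `↥Nsub` for `P` normalising `Nsub`), `continuous_conj_subgroup`,
  **`tsum_orbit_eq_integral_wt_smul_conj`** — for `γ₀ = γ₁ · P` (`γ₁, P ∈ H(L⁺)`, `P^{±1}` normalising `Nsub`), `Γ₁ = Stab(γ₁)` with weight `β₁`, and the binder
  `hconj : MeasurePreserving (u ↦ P u P⁻¹) νN νN` (unimodularity at a RATIONAL Levi element — the product formula, BY VALUE as in ★ α3-2):
  `Σ'_{q ∈ O(γ₁ P)} ∫ β(u) • f(γ_q u h) dνN = ∫ β₁(u) • f(γ₁ u (P h)) dνN`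
  — `Stab(γ₁ P) = P⁻¹ Stab(γ₁) P` carries the weight `β₁ ∘ conj(P)` (★ α1 `isCoveringWeight_comp`) and ★ α1 `integral_wt_smul_comp_mulEquiv` moves it back.
For `Nsub := klingenUnipA Ψ`, `γ₁ = Ψ(ξ)`, `P = Ψ(m_Q(1,g′))` (★ F4-3b) this is ONE orbit of the `ξ`-cell of the Q-constant term: `F(Ψ(m) h)`, `F(x) = ∫ β₁ • f(Ψ(ξ) u x)` (file F5).
SPELLING.  The orbit map is written `γ ↦ ⟦⟨(γ₀ : H(𝔸)) · γ, _⟩⟧` — the product taken in `H(𝔸)` and re-packaged in `H(L⁺)` — which is DEFINITIONALLY `⟦γ₀ · ι(γ)⟧` (★ F4-2b's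
spelling, `rfl` inside proofs) but unifies cheaply across declarations (the `H(L⁺)`-product spelling makes `whnf` diverge when two declarations' copies meet).
[MoeglinWaldspurger1995, II.1.7], [KudlaRallis1994, §2 (2.10)–(2.12)], [Garrett2018, §3.10], [CogdellAnalyticTheory2004, §2.3].
HONEST LABEL.  Count-neutral helper: `HC_CM` is proved only modulo the 7 printed citations (2 remaining named inputs: hLiu418 = `stmt-HodgeConjecture-24832`,
h413 = `stmt-HodgeConjecture-24833`) until rung 0 closes.
-/

set_option autoImplicit false
set_option linter.dupNamespace false -- the mandated namespace repeats `HodgeConjecture.HodgeConjecture`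

noncomputable section

open scoped Matrix ENNReal NNReal
open NumberField IsDedekindDomain MeasureTheory MeasureTheory.Measure Filter Set Function
open Literature.NumberTheory.Automorphic Literature.NumberTheory.GaloisRepresentations
open Literature.NumberTheory.GelbartRogawski1991 Literature.NumberTheory.GelbartRogawski1991.GRConstruction
open Literature.NumberTheory.K2Lit.SiegelDoubled Literature.MeasureTheory.Group

namespace Summit.HodgeConjecture.HodgeConjecture.Cruxes.HLiu418.K2LiuSiegelQuotSubgroupOrbitSum

open K2LiuSiegelDoubledUnfold K2LiuConstantTermBigCellUnfold K2LiuSiegelEisensteinSubgroupPeriodCells K2LiuSiegelQuotSubgroupOrbitUnfold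
  K2LiuCoveringWeightTransport

variable {L : Type} [Field L] [NumberField L] [IsCMField L]
variable {N M n : ℕ} {e : Fin N × Fin M ≃ Fin n}
  {dV : Fin N → L} {hdV : ∀ i, IsCMField.complexConj L (dV i) = dV i}
  {dW : Fin M → L} {hdW : ∀ i, IsCMField.complexConj L (dW i) = dW i}
variable {Nsub : Subgroup (HA L e dV hdV dW hdW)}

/-! ## §1 The section of `Stab(γ₀)\N(L⁺)` carried by the orbit set -/

/-- **THE ORBIT SET CARRIES A SECTION**: with `Γ' = Stab(γ₀) = {u ∈ N(L⁺) : γ₀ u γ₀⁻¹ ∈ P_Δ}` (membership law) there is `q ↦ ν_q ∈ N(L⁺)` on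
`O(γ₀) = {⟦γ₀ ν⟧}` with `⟦γ₀ ν_q⟧ = q` and `∀ γ ∈ N(L⁺), ∃! q, γ ν_q⁻¹ ∈ Γ'` (the orbit IS `Γ'\N(L⁺)`). [cite: MoeglinWaldspurger1995, II.1.7] -/
theorem exists_section_of_orbit (γ₀ : ratH L e dV hdV dW hdW) (Γ' : Subgroup Nsub)
    (hΓ' : ∀ u : Nsub, u ∈ Γ' ↔ (u : HA L e dV hdV dW hdW) ∈ ratH L e dV hdV dW hdW ∧
      IsSiegelDelta L e dV hdV dW hdW ((γ₀ : HA L e dV hdV dW hdW) * (u : HA L e dV hdV dW hdW) * ((γ₀ : HA L e dV hdV dW hdW))⁻¹)) :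
    ∃ ν : ↥(Set.range (fun γ : (ratH L e dV hdV dW hdW).subgroupOf Nsub =>
        (Quotient.mk (MulAction.orbitRel (siegelDeltaRat L e dV hdV dW hdW) (ratH L e dV hdV dW hdW))
          (⟨(γ₀ : HA L e dV hdV dW hdW) * ((γ : Nsub) : HA L e dV hdV dW hdW), mul_mem γ₀.2 (coe_coe_mem_ratH γ)⟩ : ratH L e dV hdV dW hdW) :
            SiegelDeltaQuot L e dV hdV dW hdW))) →
        (ratH L e dV hdV dW hdW).subgroupOf Nsub,
      (∀ q, (Quotient.mk (MulAction.orbitRel (siegelDeltaRat L e dV hdV dW hdW) (ratH L e dV hdV dW hdW))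
          (⟨(γ₀ : HA L e dV hdV dW hdW) * (((ν q : (ratH L e dV hdV dW hdW).subgroupOf Nsub) : Nsub) : HA L e dV hdV dW hdW),
            mul_mem γ₀.2 (coe_coe_mem_ratH (ν q))⟩ : ratH L e dV hdV dW hdW) : SiegelDeltaQuot L e dV hdV dW hdW) = q.1) ∧
      ∀ γ ∈ (ratH L e dV hdV dW hdW).subgroupOf Nsub, ∃! q, γ * (((ν q : (ratH L e dV hdV dW hdW).subgroupOf Nsub) : Nsub))⁻¹ ∈ Γ' := by
  classical
  -- the two spellings of `γ₀ · γ ∈ H(L⁺)` (product in `H(𝔸)` vs in `H(L⁺)`) agree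
  have hι : ∀ γ : (ratH L e dV hdV dW hdW).subgroupOf Nsub,
      (⟨(γ₀ : HA L e dV hdV dW hdW) * ((γ : Nsub) : HA L e dV hdV dW hdW), mul_mem γ₀.2 (coe_coe_mem_ratH γ)⟩ : ratH L e dV hdV dW hdW) =
        γ₀ * ⟨((γ : Nsub) : HA L e dV hdV dW hdW), coe_coe_mem_ratH γ⟩ := fun γ => rfl
  -- `⟦γ₀ a⟧ = ⟦γ₀ b⟧ ⟹ a b⁻¹ ∈ Γ'` and conversely (★ F4-2b `mk_mul_coe_eq_mk_mul_coe_iff` + the membership law)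
  have hstab : ∀ a b : (ratH L e dV hdV dW hdW).subgroupOf Nsub,
      (Quotient.mk (MulAction.orbitRel (siegelDeltaRat L e dV hdV dW hdW) (ratH L e dV hdV dW hdW))
          (⟨(γ₀ : HA L e dV hdV dW hdW) * ((a : Nsub) : HA L e dV hdV dW hdW), mul_mem γ₀.2 (coe_coe_mem_ratH a)⟩ : ratH L e dV hdV dW hdW) :
            SiegelDeltaQuot L e dV hdV dW hdW) =
        Quotient.mk (MulAction.orbitRel (siegelDeltaRat L e dV hdV dW hdW) (ratH L e dV hdV dW hdW))
          (⟨(γ₀ : HA L e dV hdV dW hdW) * ((b : Nsub) : HA L e dV hdV dW hdW), mul_mem γ₀.2 (coe_coe_mem_ratH b)⟩ : ratH L e dV hdV dW hdW) →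
      (a : Nsub) * ((b : Nsub))⁻¹ ∈ Γ' := fun a b hab => by
    rw [hι, hι] at hab
    exact (hΓ' _).2 ⟨coe_coe_mem_ratH (a * b⁻¹), (mk_mul_coe_eq_mk_mul_coe_iff γ₀ a b).1 hab⟩
  have hstab' : ∀ a b : (ratH L e dV hdV dW hdW).subgroupOf Nsub, (a : Nsub) * ((b : Nsub))⁻¹ ∈ Γ' →
      (Quotient.mk (MulAction.orbitRel (siegelDeltaRat L e dV hdV dW hdW) (ratH L e dV hdV dW hdW))
          (⟨(γ₀ : HA L e dV hdV dW hdW) * ((a : Nsub) : HA L e dV hdV dW hdW), mul_mem γ₀.2 (coe_coe_mem_ratH a)⟩ : ratH L e dV hdV dW hdW) :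
            SiegelDeltaQuot L e dV hdV dW hdW) =
        Quotient.mk (MulAction.orbitRel (siegelDeltaRat L e dV hdV dW hdW) (ratH L e dV hdV dW hdW))
          (⟨(γ₀ : HA L e dV hdV dW hdW) * ((b : Nsub) : HA L e dV hdV dW hdW), mul_mem γ₀.2 (coe_coe_mem_ratH b)⟩ : ratH L e dV hdV dW hdW) :=
    fun a b hab => by
    rw [hι, hι]
    exact (mk_mul_coe_eq_mk_mul_coe_iff γ₀ a b).2 ((hΓ' _).1 hab).2
  -- the section
  have hsec : ∀ q : ↥(Set.range (fun γ : (ratH L e dV hdV dW hdW).subgroupOf Nsub =>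
      (Quotient.mk (MulAction.orbitRel (siegelDeltaRat L e dV hdV dW hdW) (ratH L e dV hdV dW hdW))
        (⟨(γ₀ : HA L e dV hdV dW hdW) * ((γ : Nsub) : HA L e dV hdV dW hdW), mul_mem γ₀.2 (coe_coe_mem_ratH γ)⟩ : ratH L e dV hdV dW hdW) :
            SiegelDeltaQuot L e dV hdV dW hdW))),
      ∃ ν₁ : (ratH L e dV hdV dW hdW).subgroupOf Nsub,
        (Quotient.mk (MulAction.orbitRel (siegelDeltaRat L e dV hdV dW hdW) (ratH L e dV hdV dW hdW))
          (⟨(γ₀ : HA L e dV hdV dW hdW) * ((ν₁ : Nsub) : HA L e dV hdV dW hdW), mul_mem γ₀.2 (coe_coe_mem_ratH ν₁)⟩ : ratH L e dV hdV dW hdW) :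
            SiegelDeltaQuot L e dV hdV dW hdW) = q.1 := fun q => q.2
  choose ν hνq using hsec
  refine ⟨ν, hνq, fun γ hγ => ?_⟩
  exact ⟨⟨_, ⟨γ, hγ⟩, rfl⟩, hstab ⟨γ, hγ⟩ _ (by rw [hνq]), fun j hj => Subtype.ext (by rw [← hνq j]; exact (hstab' ⟨γ, hγ⟩ _ hj).symm)⟩

/-! ## §2 The orbit sum as one weighted integral, for any stabiliser weight -/

section Orbit

variable [MeasurableSpace Nsub] [BorelSpace Nsub]

/-- **THE ORBIT PIECE OF (H) BOUNDS `∫⁻ ‖f(γ₀ u h)‖ₑ β₁ dνN` for every `Stab(γ₀)`-weight `β₁`** (Tonelli over the section of §1, ★ F4-2b `lintegral_enorm_section_unfold`).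
[cite: MoeglinWaldspurger1995, II.1.7] [cite: CogdellAnalyticTheory2004, §2.3] -/
theorem lintegral_orbit_ne_top_subgroup (νN : Measure Nsub) [νN.IsMulLeftInvariant]
    {β : Nsub → ℝ≥0∞} (hβ : IsCoveringWeight ((ratH L e dV hdV dW hdW).subgroupOf Nsub) β)
    {χ : HeckeCharacter L} {s : ℂ} {f : HA L e dV hdV dW hdW → ℂ} (hf : IsSiegelDeltaSection L e dV hdV dW hdW χ s f) (hfc : Continuous f)
    (γ₀ : ratH L e dV hdV dW hdW) (h : HA L e dV hdV dW hdW) (Γ' : Subgroup Nsub)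
    (hΓ' : ∀ u : Nsub, u ∈ Γ' ↔ (u : HA L e dV hdV dW hdW) ∈ ratH L e dV hdV dW hdW ∧
      IsSiegelDelta L e dV hdV dW hdW ((γ₀ : HA L e dV hdV dW hdW) * (u : HA L e dV hdV dW hdW) * ((γ₀ : HA L e dV hdV dW hdW))⁻¹))
    {β₁ : Nsub → ℝ≥0∞} (hβ₁ : IsCoveringWeight Γ' β₁)
    (hO : ∫⁻ u, (∑' q : ↥(Set.range (fun γ : (ratH L e dV hdV dW hdW).subgroupOf Nsub =>
        (Quotient.mk (MulAction.orbitRel (siegelDeltaRat L e dV hdV dW hdW) (ratH L e dV hdV dW hdW))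
          (⟨(γ₀ : HA L e dV hdV dW hdW) * ((γ : Nsub) : HA L e dV hdV dW hdW), mul_mem γ₀.2 (coe_coe_mem_ratH γ)⟩ : ratH L e dV hdV dW hdW) :
            SiegelDeltaQuot L e dV hdV dW hdW))),
        ‖f (((Quotient.out q.1 : ratH L e dV hdV dW hdW) : HA L e dV hdV dW hdW) * ((u : HA L e dV hdV dW hdW) * h))‖ₑ) * β u ∂νN ≠ ∞) :
    ∫⁻ u, ‖f ((γ₀ : HA L e dV hdV dW hdW) * (u : HA L e dV hdV dW hdW) * h)‖ₑ * β₁ u ∂νN ≠ ∞ := by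
  haveI : Countable (ratH L e dV hdV dW hdW) := countable_ratH L e dV hdV dW hdW
  haveI : Countable (SiegelDeltaQuot L e dV hdV dW hdW) := by unfold SiegelDeltaQuot; exact inferInstance
  have hΓ'le : Γ' ≤ (ratH L e dV hdV dW hdW).subgroupOf Nsub := fun u hu => Subgroup.mem_subgroupOf.2 ((hΓ' u).1 hu).1
  have hΓ'P : ∀ γ ∈ Γ', IsSiegelDelta L e dV hdV dW hdW
      ((γ₀ : HA L e dV hdV dW hdW) * ((γ : Nsub) : HA L e dV hdV dW hdW) * ((γ₀ : HA L e dV hdV dW hdW))⁻¹) := fun γ hγ => ((hΓ' γ).1 hγ).2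
  obtain ⟨ν, hνq, hν⟩ := exists_section_of_orbit γ₀ Γ' hΓ'
  have hout : ∀ (q : ↥(Set.range (fun γ : (ratH L e dV hdV dW hdW).subgroupOf Nsub =>
        (Quotient.mk (MulAction.orbitRel (siegelDeltaRat L e dV hdV dW hdW) (ratH L e dV hdV dW hdW))
          (⟨(γ₀ : HA L e dV hdV dW hdW) * ((γ : Nsub) : HA L e dV hdV dW hdW), mul_mem γ₀.2 (coe_coe_mem_ratH γ)⟩ : ratH L e dV hdV dW hdW) :
            SiegelDeltaQuot L e dV hdV dW hdW)))) (x : HA L e dV hdV dW hdW),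
      f (((Quotient.out q.1 : ratH L e dV hdV dW hdW) : HA L e dV hdV dW hdW) * x) =
        f ((γ₀ : HA L e dV hdV dW hdW) * (((ν q : (ratH L e dV hdV dW hdW).subgroupOf Nsub) : Nsub) : HA L e dV hdV dW hdW) * x) := by
    intro q x
    rw [← apply_out_mul_coe_mul hf γ₀ (ν q) x]
    have hι : (⟨(γ₀ : HA L e dV hdV dW hdW) * (((ν q : (ratH L e dV hdV dW hdW).subgroupOf Nsub) : Nsub) : HA L e dV hdV dW hdW),
        mul_mem γ₀.2 (coe_coe_mem_ratH (ν q))⟩ : ratH L e dV hdV dW hdW) =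
        γ₀ * ⟨(((ν q : (ratH L e dV hdV dW hdW).subgroupOf Nsub) : Nsub) : HA L e dV hdV dW hdW), coe_coe_mem_ratH (ν q)⟩ := rfl
    rw [← hι]
    congr 4
    exact (hνq q).symm
  simp only [hout] at hO
  rw [lintegral_enorm_section_unfold νN hβ hf hfc γ₀ h Γ' hΓ'le hΓ'P hβ₁ ν hν]
  exact hO

/-- **THE SUM OVER ONE `N(L⁺)`-ORBIT IS ONE WEIGHTED INTEGRAL, FOR ANY STABILISER WEIGHT** (orbit-set form of ★ F4-2b): `νN` left-invariant on `↥Nsub`, `β` an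
`N(L⁺)`-covering weight, `f` a continuous Siegel section, `γ₀ ∈ H(L⁺)`, `h ∈ H(𝔸)`, `Γ' = Stab(γ₀)` (membership law), `β₁` ANY `Γ'`-covering weight, and the orbit piece of
(H).  Then `Σ'_{q ∈ O(γ₀)} ∫ β(u) • f(γ_q u h) dνN(u) = ∫ β₁(u) • f(γ₀ u h) dνN(u)`. [cite: MoeglinWaldspurger1995, II.1.7] [cite: KudlaRallis1994, §2] [cite: Garrett2018, §3.10] -/
theorem tsum_orbit_eq_integral_wt_smul_subgroup' (νN : Measure Nsub) [νN.IsMulLeftInvariant]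
    {β : Nsub → ℝ≥0∞} (hβ : IsCoveringWeight ((ratH L e dV hdV dW hdW).subgroupOf Nsub) β)
    {χ : HeckeCharacter L} {s : ℂ} {f : HA L e dV hdV dW hdW → ℂ} (hf : IsSiegelDeltaSection L e dV hdV dW hdW χ s f) (hfc : Continuous f)
    (γ₀ : ratH L e dV hdV dW hdW) (h : HA L e dV hdV dW hdW) (Γ' : Subgroup Nsub)
    (hΓ' : ∀ u : Nsub, u ∈ Γ' ↔ (u : HA L e dV hdV dW hdW) ∈ ratH L e dV hdV dW hdW ∧
      IsSiegelDelta L e dV hdV dW hdW ((γ₀ : HA L e dV hdV dW hdW) * (u : HA L e dV hdV dW hdW) * ((γ₀ : HA L e dV hdV dW hdW))⁻¹))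
    {β₁ : Nsub → ℝ≥0∞} (hβ₁ : IsCoveringWeight Γ' β₁)
    (hO : ∫⁻ u, (∑' q : ↥(Set.range (fun γ : (ratH L e dV hdV dW hdW).subgroupOf Nsub =>
        (Quotient.mk (MulAction.orbitRel (siegelDeltaRat L e dV hdV dW hdW) (ratH L e dV hdV dW hdW))
          (⟨(γ₀ : HA L e dV hdV dW hdW) * ((γ : Nsub) : HA L e dV hdV dW hdW), mul_mem γ₀.2 (coe_coe_mem_ratH γ)⟩ : ratH L e dV hdV dW hdW) :
            SiegelDeltaQuot L e dV hdV dW hdW))),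
        ‖f (((Quotient.out q.1 : ratH L e dV hdV dW hdW) : HA L e dV hdV dW hdW) * ((u : HA L e dV hdV dW hdW) * h))‖ₑ) * β u ∂νN ≠ ∞) :
    ∑' q : ↥(Set.range (fun γ : (ratH L e dV hdV dW hdW).subgroupOf Nsub =>
        (Quotient.mk (MulAction.orbitRel (siegelDeltaRat L e dV hdV dW hdW) (ratH L e dV hdV dW hdW))
          (⟨(γ₀ : HA L e dV hdV dW hdW) * ((γ : Nsub) : HA L e dV hdV dW hdW), mul_mem γ₀.2 (coe_coe_mem_ratH γ)⟩ : ratH L e dV hdV dW hdW) :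
            SiegelDeltaQuot L e dV hdV dW hdW))),
      ∫ u, (β u).toReal • f (((Quotient.out q.1 : ratH L e dV hdV dW hdW) : HA L e dV hdV dW hdW) * ((u : HA L e dV hdV dW hdW) * h)) ∂νN =
      ∫ u, (β₁ u).toReal • f ((γ₀ : HA L e dV hdV dW hdW) * (u : HA L e dV hdV dW hdW) * h) ∂νN := by
  haveI : Countable (ratH L e dV hdV dW hdW) := countable_ratH L e dV hdV dW hdW
  haveI : Countable (SiegelDeltaQuot L e dV hdV dW hdW) := by unfold SiegelDeltaQuot; exact inferInstance
  have hΓ'le : Γ' ≤ (ratH L e dV hdV dW hdW).subgroupOf Nsub := fun u hu => Subgroup.mem_subgroupOf.2 ((hΓ' u).1 hu).1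
  have hΓ'P : ∀ γ ∈ Γ', IsSiegelDelta L e dV hdV dW hdW
      ((γ₀ : HA L e dV hdV dW hdW) * ((γ : Nsub) : HA L e dV hdV dW hdW) * ((γ₀ : HA L e dV hdV dW hdW))⁻¹) := fun γ hγ => ((hΓ' γ).1 hγ).2
  obtain ⟨ν, hνq, hν⟩ := exists_section_of_orbit γ₀ Γ' hΓ'
  have hout : ∀ (q : ↥(Set.range (fun γ : (ratH L e dV hdV dW hdW).subgroupOf Nsub =>
        (Quotient.mk (MulAction.orbitRel (siegelDeltaRat L e dV hdV dW hdW) (ratH L e dV hdV dW hdW))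
          (⟨(γ₀ : HA L e dV hdV dW hdW) * ((γ : Nsub) : HA L e dV hdV dW hdW), mul_mem γ₀.2 (coe_coe_mem_ratH γ)⟩ : ratH L e dV hdV dW hdW) :
            SiegelDeltaQuot L e dV hdV dW hdW)))) (x : HA L e dV hdV dW hdW),
      f (((Quotient.out q.1 : ratH L e dV hdV dW hdW) : HA L e dV hdV dW hdW) * x) =
        f ((γ₀ : HA L e dV hdV dW hdW) * (((ν q : (ratH L e dV hdV dW hdW).subgroupOf Nsub) : Nsub) : HA L e dV hdV dW hdW) * x) := by
    intro q x
    rw [← apply_out_mul_coe_mul hf γ₀ (ν q) x]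
    have hι : (⟨(γ₀ : HA L e dV hdV dW hdW) * (((ν q : (ratH L e dV hdV dW hdW).subgroupOf Nsub) : Nsub) : HA L e dV hdV dW hdW),
        mul_mem γ₀.2 (coe_coe_mem_ratH (ν q))⟩ : ratH L e dV hdV dW hdW) =
        γ₀ * ⟨(((ν q : (ratH L e dV hdV dW hdW).subgroupOf Nsub) : Nsub) : HA L e dV hdV dW hdW), coe_coe_mem_ratH (ν q)⟩ := rfl
    rw [← hι]
    congr 4
    exact (hνq q).symm
  simp only [hout] at hO ⊢
  exact tsum_section_eq_integral_wt_smul_subgroup νN hβ hf hfc γ₀ h Γ' hΓ'le hΓ'P hβ₁ ν hν hO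

end Orbit

/-! ## §3 Transport along a conjugation `u ↦ P u P⁻¹` normalising `Nsub` -/

/-- **the conjugation automorphism of `↥Nsub` by an element `p ∈ H(𝔸)` with `p^{±1} Nsub p^{∓1} ⊆ Nsub`**, as a `MulEquiv` with its values (★ α3-1 for `unipDelta`).
[cite: MoeglinWaldspurger1995, I.2.1] -/
theorem exists_conj_mulEquiv_subgroup (p : HA L e dV hdV dW hdW) (hp : ∀ u : HA L e dV hdV dW hdW, u ∈ Nsub → p * u * p⁻¹ ∈ Nsub)
    (hp' : ∀ u : HA L e dV hdV dW hdW, u ∈ Nsub → p⁻¹ * u * p ∈ Nsub) :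
    ∃ φ : Nsub ≃* Nsub, (∀ u : Nsub, ((φ u : Nsub) : HA L e dV hdV dW hdW) = p * (u : HA L e dV hdV dW hdW) * p⁻¹) ∧
      ∀ u : Nsub, ((φ.symm u : Nsub) : HA L e dV hdV dW hdW) = p⁻¹ * (u : HA L e dV hdV dW hdW) * p :=
  ⟨{ toFun := fun u => ⟨p * (u : HA L e dV hdV dW hdW) * p⁻¹, hp _ u.2⟩,
     invFun := fun u => ⟨p⁻¹ * (u : HA L e dV hdV dW hdW) * p, hp' _ u.2⟩,
     left_inv := fun u => Subtype.ext (by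
       show p⁻¹ * (p * (u : HA L e dV hdV dW hdW) * p⁻¹) * p = u
       simp only [mul_assoc, inv_mul_cancel_left, inv_mul_cancel, mul_one]),
     right_inv := fun u => Subtype.ext (by
       show p * (p⁻¹ * (u : HA L e dV hdV dW hdW) * p) * p⁻¹ = u
       simp only [mul_assoc, mul_inv_cancel_left, mul_inv_cancel, mul_one]),
     map_mul' := fun u v => Subtype.ext (by
       show p * ((u : HA L e dV hdV dW hdW) * (v : HA L e dV hdV dW hdW)) * p⁻¹ = p * (u : HA L e dV hdV dW hdW) * p⁻¹ * (p * (v : HA L e dV hdV dW hdW) * p⁻¹)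
       simp only [mul_assoc, inv_mul_cancel_left]) }, fun _ => rfl, fun _ => rfl⟩

/-- a map of `↥Nsub` whose values are `p · u · q` is continuous. [folklore] -/
theorem continuous_of_coe_eq_mul_mul {φ : Nsub → Nsub} (p q : HA L e dV hdV dW hdW) (hφ : ∀ u : Nsub, ((φ u : Nsub) : HA L e dV hdV dW hdW) = p * (u : HA L e dV hdV dW hdW) * q) :
    Continuous φ := by
  have h : Continuous fun u : Nsub => ((φ u : Nsub) : HA L e dV hdV dW hdW) := by
    simp_rw [hφ]
    exact (continuous_const.mul continuous_subtype_val).mul continuous_const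
  exact continuous_induced_rng.2 h

section Conj

variable [MeasurableSpace Nsub] [BorelSpace Nsub]

/-- **THE ORBIT OF `⟦γ₁ P⟧` TRANSPORTED TO `γ₁`.**  `νN` left-invariant on `↥Nsub`; `β` an `N(L⁺)`-covering weight; `f` a continuous Siegel section; `γ₁, P ∈ H(L⁺)` with
`P^{±1}` normalising `Nsub`; `Γ₁ = Stab(γ₁)` (membership law) with a `Γ₁`-covering weight `β₁`; the binder `hconj : MeasurePreserving (u ↦ P u P⁻¹) νN νN`; and the
orbit piece of (H) for `γ₀ := γ₁ P`.  THEN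
  `Σ'_{q ∈ O(γ₁ P)} ∫ β(u) • f(γ_q u h) dνN(u) = ∫ β₁(u) • f(γ₁ u (P h)) dνN(u)`
(§2 at `Γ' = Stab(γ₁ P) = P⁻¹ Γ₁ P = Γ₁.comap (conj P)` with the weight `β₁ ∘ conj P` (★ α1 `isCoveringWeight_comp`); `γ₁ P u h = γ₁ (P u P⁻¹) (P h)`;
★ α1 `integral_wt_smul_comp_mulEquiv` along the `νN`-preserving `conj P`). [cite: MoeglinWaldspurger1995, II.1.7] [cite: KudlaRallis1994, §2] [cite: CogdellAnalyticTheory2004, §2.3] -/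
theorem tsum_orbit_eq_integral_wt_smul_conj (νN : Measure Nsub) [νN.IsMulLeftInvariant]
    {β : Nsub → ℝ≥0∞} (hβ : IsCoveringWeight ((ratH L e dV hdV dW hdW).subgroupOf Nsub) β)
    {χ : HeckeCharacter L} {s : ℂ} {f : HA L e dV hdV dW hdW → ℂ} (hf : IsSiegelDeltaSection L e dV hdV dW hdW χ s f) (hfc : Continuous f)
    (γ₁ P : ratH L e dV hdV dW hdW) (h : HA L e dV hdV dW hdW)
    (hP : ∀ u : HA L e dV hdV dW hdW, u ∈ Nsub → (P : HA L e dV hdV dW hdW) * u * ((P : HA L e dV hdV dW hdW))⁻¹ ∈ Nsub)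
    (hP' : ∀ u : HA L e dV hdV dW hdW, u ∈ Nsub → ((P : HA L e dV hdV dW hdW))⁻¹ * u * (P : HA L e dV hdV dW hdW) ∈ Nsub)
    (Γ₁ : Subgroup Nsub)
    (hΓ₁ : ∀ u : Nsub, u ∈ Γ₁ ↔ (u : HA L e dV hdV dW hdW) ∈ ratH L e dV hdV dW hdW ∧
      IsSiegelDelta L e dV hdV dW hdW ((γ₁ : HA L e dV hdV dW hdW) * (u : HA L e dV hdV dW hdW) * ((γ₁ : HA L e dV hdV dW hdW))⁻¹))
    {β₁ : Nsub → ℝ≥0∞} (hβ₁ : IsCoveringWeight Γ₁ β₁)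
    (hconj : MeasurePreserving (fun u : Nsub => (⟨(P : HA L e dV hdV dW hdW) * (u : HA L e dV hdV dW hdW) * ((P : HA L e dV hdV dW hdW))⁻¹, hP _ u.2⟩ : Nsub)) νN νN)
    (hO : ∫⁻ u, (∑' q : ↥(Set.range (fun γ : (ratH L e dV hdV dW hdW).subgroupOf Nsub =>
        (Quotient.mk (MulAction.orbitRel (siegelDeltaRat L e dV hdV dW hdW) (ratH L e dV hdV dW hdW))
          (⟨((γ₁ * P : ratH L e dV hdV dW hdW) : HA L e dV hdV dW hdW) * ((γ : Nsub) : HA L e dV hdV dW hdW), mul_mem (γ₁ * P).2 (coe_coe_mem_ratH γ)⟩ :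
            ratH L e dV hdV dW hdW) : SiegelDeltaQuot L e dV hdV dW hdW))),
        ‖f (((Quotient.out q.1 : ratH L e dV hdV dW hdW) : HA L e dV hdV dW hdW) * ((u : HA L e dV hdV dW hdW) * h))‖ₑ) * β u ∂νN ≠ ∞) :
    ∑' q : ↥(Set.range (fun γ : (ratH L e dV hdV dW hdW).subgroupOf Nsub =>
        (Quotient.mk (MulAction.orbitRel (siegelDeltaRat L e dV hdV dW hdW) (ratH L e dV hdV dW hdW))
          (⟨((γ₁ * P : ratH L e dV hdV dW hdW) : HA L e dV hdV dW hdW) * ((γ : Nsub) : HA L e dV hdV dW hdW), mul_mem (γ₁ * P).2 (coe_coe_mem_ratH γ)⟩ :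
            ratH L e dV hdV dW hdW) : SiegelDeltaQuot L e dV hdV dW hdW))),
      ∫ u, (β u).toReal • f (((Quotient.out q.1 : ratH L e dV hdV dW hdW) : HA L e dV hdV dW hdW) * ((u : HA L e dV hdV dW hdW) * h)) ∂νN =
      ∫ u, (β₁ u).toReal • f ((γ₁ : HA L e dV hdV dW hdW) * (u : HA L e dV hdV dW hdW) * ((P : HA L e dV hdV dW hdW) * h)) ∂νN := by
  haveI : Countable ((ratH L e dV hdV dW hdW).subgroupOf Nsub) := countable_subgroupOf_ratH Nsub
  -- the conjugation `φ = conj(P)` of `↥Nsub`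
  obtain ⟨φ, hφ, hφs⟩ := exists_conj_mulEquiv_subgroup (Nsub := Nsub) (P : HA L e dV hdV dW hdW) hP hP'
  have hφc : Continuous φ := continuous_of_coe_eq_mul_mul _ _ hφ
  have hφsc : Continuous φ.symm := continuous_of_coe_eq_mul_mul _ _ hφs
  have hφm : Measurable φ := hφc.measurable
  have hφsm : Measurable φ.symm := hφsc.measurable
  have hφfun : (φ : Nsub → Nsub) = fun u : Nsub =>
      (⟨(P : HA L e dV hdV dW hdW) * (u : HA L e dV hdV dW hdW) * ((P : HA L e dV hdV dW hdW))⁻¹, hP _ u.2⟩ : Nsub) :=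
    funext fun u => Subtype.ext (hφ u)
  have hmp : MeasurePreserving φ νN νN := by rw [hφfun]; exact hconj
  -- `Stab(γ₁ P) = Γ₁.comap φ`, with the weight `β₁ ∘ φ`
  set Γ' : Subgroup Nsub := Γ₁.comap φ.toMonoidHom with hΓ'def
  have hΓ' : ∀ u : Nsub, u ∈ Γ' ↔ (u : HA L e dV hdV dW hdW) ∈ ratH L e dV hdV dW hdW ∧
      IsSiegelDelta L e dV hdV dW hdW (((γ₁ * P : ratH L e dV hdV dW hdW) : HA L e dV hdV dW hdW) * (u : HA L e dV hdV dW hdW) *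
        (((γ₁ * P : ratH L e dV hdV dW hdW) : HA L e dV hdV dW hdW))⁻¹) := by
    intro u
    rw [hΓ'def, Subgroup.mem_comap, MulEquiv.coe_toMonoidHom, hΓ₁, hφ u]
    have hconj_eq : (γ₁ : HA L e dV hdV dW hdW) * ((P : HA L e dV hdV dW hdW) * (u : HA L e dV hdV dW hdW) * ((P : HA L e dV hdV dW hdW))⁻¹) *
        ((γ₁ : HA L e dV hdV dW hdW))⁻¹ =
      ((γ₁ * P : ratH L e dV hdV dW hdW) : HA L e dV hdV dW hdW) * (u : HA L e dV hdV dW hdW) * (((γ₁ * P : ratH L e dV hdV dW hdW) : HA L e dV hdV dW hdW))⁻¹ := by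
      rw [Subgroup.coe_mul, mul_inv_rev]; simp only [mul_assoc]
    rw [hconj_eq]
    have hrat : (P : HA L e dV hdV dW hdW) * (u : HA L e dV hdV dW hdW) * ((P : HA L e dV hdV dW hdW))⁻¹ ∈ ratH L e dV hdV dW hdW ↔
        (u : HA L e dV hdV dW hdW) ∈ ratH L e dV hdV dW hdW := by
      constructor
      · intro hh
        have h2 := mul_mem (mul_mem (inv_mem P.2) hh) P.2
        simpa only [mul_assoc, inv_mul_cancel_left, inv_mul_cancel, mul_one] using h2
      · intro hh
        exact mul_mem (mul_mem P.2 hh) (inv_mem P.2)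
    rw [hrat]
  have hβ' : IsCoveringWeight Γ' (β₁ ∘ φ) := isCoveringWeight_comp φ hφm Γ₁ hβ₁
  -- §2 at `Γ'`, weight `β₁ ∘ φ`
  rw [tsum_orbit_eq_integral_wt_smul_subgroup' νN hβ hf hfc (γ₁ * P) h Γ' hΓ' hβ' hO]
  -- `γ₁ P u h = γ₁ (φ u) (P h)` and the change of variables along `φ`
  have hid : ∀ u : Nsub, ((γ₁ * P : ratH L e dV hdV dW hdW) : HA L e dV hdV dW hdW) * (u : HA L e dV hdV dW hdW) * h =
      (γ₁ : HA L e dV hdV dW hdW) * ((φ u : Nsub) : HA L e dV hdV dW hdW) * ((P : HA L e dV hdV dW hdW) * h) := fun u => by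
    rw [hφ u, Subgroup.coe_mul]; simp only [mul_assoc, inv_mul_cancel_left]
  simp_rw [hid]
  have hΓ₁rat : ∀ γ ∈ Γ₁, ((γ : Nsub) : HA L e dV hdV dW hdW) ∈ ratH L e dV hdV dW hdW := fun γ hγ => ((hΓ₁ γ).1 hγ).1
  have hΓ₁P : ∀ γ ∈ Γ₁, IsSiegelDelta L e dV hdV dW hdW
      ((γ₁ : HA L e dV hdV dW hdW) * ((γ : Nsub) : HA L e dV hdV dW hdW) * ((γ₁ : HA L e dV hdV dW hdW))⁻¹) := fun γ hγ => ((hΓ₁ γ).1 hγ).2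
  haveI : Countable Γ₁ := by
    have hle : Γ₁ ≤ (ratH L e dV hdV dW hdW).subgroupOf Nsub := fun u hu => Subgroup.mem_subgroupOf.2 (hΓ₁rat u hu)
    exact (Subgroup.inclusion_injective hle).countable
  have hFm : StronglyMeasurable fun x : Nsub => f ((γ₁ : HA L e dV hdV dW hdW) * (x : HA L e dV hdV dW hdW) * ((P : HA L e dV hdV dW hdW) * h)) :=
    (hfc.comp ((continuous_const.mul continuous_subtype_val).mul continuous_const)).stronglyMeasurable
  have hFinv : ∀ γ ∈ Γ₁, ∀ x : Nsub, f ((γ₁ : HA L e dV hdV dW hdW) * (((γ * x : Nsub)) : HA L e dV hdV dW hdW) * ((P : HA L e dV hdV dW hdW) * h)) =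
      f ((γ₁ : HA L e dV hdV dW hdW) * (x : HA L e dV hdV dW hdW) * ((P : HA L e dV hdV dW hdW) * h)) :=
    fun γ hγ x => apply_coe_mul_of_mem hf γ₁ _ Γ₁ hΓ₁rat hΓ₁P hγ x
  -- finiteness of `∫⁻ ‖f(γ₁ x (P h))‖ₑ β₁`: transport of the `Γ'`-bound of §2
  have hint : ∫⁻ x, ‖f ((γ₁ : HA L e dV hdV dW hdW) * (x : HA L e dV hdV dW hdW) * ((P : HA L e dV hdV dW hdW) * h))‖ₑ * β₁ x ∂νN ≠ ∞ := by
    have h1 := lintegral_orbit_ne_top_subgroup νN hβ hf hfc (γ₁ * P) h Γ' hΓ' hβ' hO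
    simp_rw [hid] at h1
    rw [← lintegral_mul_comp_mulEquiv νN φ hφm hφsm hmp Γ₁ hβ₁ hβ'
      (F := fun x : Nsub => ‖f ((γ₁ : HA L e dV hdV dW hdW) * (x : HA L e dV hdV dW hdW) * ((P : HA L e dV hdV dW hdW) * h))‖ₑ) hFm.measurable.enorm
      (fun γ hγ x => by rw [hFinv γ hγ x])]
    exact h1
  exact integral_wt_smul_comp_mulEquiv νN φ hφm hφsm hmp Γ₁ hβ₁ hβ' hFm hFinv hint

end Conj

end Summit.HodgeConjecture.HodgeConjecture.Cruxes.HLiu418.K2LiuSiegelQuotSubgroupOrbitSum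

end
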